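import Summits.Ventures.Crystal3D.Theorems.StickyWulffConstantGenericWallFloorBarlowCoverableGlueApart
import Summits.Ventures.Crystal3D.Theorems.StickyWulffConstantTextureLiminfTexShadowCornerFramesDefs
import HarnessLib

/-!
# Lane T's zig `hlines` keyed BY NAME on `ZigGood₁ ∧ ZigGood₂ ∧ FramesApart` (option (C)): `barlow_hlines_framesApart`
# (crux `GenericWallFloor`, stmt-Ventures-19480, line `WallLedgerG`; v6.13 parts v4 `WalkerCovered′`, cf-p1 19:29:34Z / 19:39:56Z)

HONEST FRAMING. Venture `Summits/Ventures/Crystal3D` (cell `crystal3d-full`), helper `--supports` the crux `GenericWallFloor`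
(stmt-Ventures-19480) of `route-Ventures-StickyWulffConstant`, registered line `WallLedgerG`, open stub `stub_twoSlabAdhesion`.
Rung credit only; F-C1 not moved; NOT the stub.  Inputs BY NAME: E1 (`hsE`, `hcert`), `DoubleStarCoaxialAt` / `CapPairCoaxial`
(`hDS`, `hCP`, from `StarPairFar`).

`barlow_hlines_zigApart` (`…BarlowCoverableGlueApart`) takes the three zig-corner FRAME clauses explicitly.  When both plates are
`ZigGood` (Δ-steep AND all bilayer rises `≥ √2/2`), the corner frame sets of `FramesApart` (`…TexShadowCornerFramesDefs`) ARE the zig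
sets (`corner_of_zigGood`), so the clauses are literally `FramesApart`'s (i), (ii) and `framesApart_sep`.  This file records that
one-line derivation so lane T can close a `WalkerCovered′ := ZigGood₁ ∧ ZigGood₂ ∧ … ∧ FramesApart` part by name.
* **`barlow_hlines_framesApart`** — `ZigGood L₁ σ₁ e₃ → ZigGood L₂ σ₂ (−e₃) → FramesApart L₁ s₁ σ₁ L₂ s₂ σ₂ →` the conclusion of
  `barlow_hlines_coverable` verbatim (`#T₁ + #T₂ + 18 m ρ ≤ Σ_PAY(12−deg) + (318 + 192 R₀)(1+h)ρ`).
WHAT THIS IS NOT: Δ-steep plates that are not `ZigGood` run ROWS in `FramesApart`'s corner convention — that case is the row-covered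
part (`barlow_rowhlines_apart`, `…BarlowRowCovGlueApart`); F-C1 not moved.
-/

noncomputable section

namespace Summit.Ventures.Crystal3D.Theorems

open Finset
open Literature.MathematicalPhysics.StatisticalMechanics (IsHaggSeq triangularVec₁ triangularVec₂ fccStacking)
open Summit.Ventures.Crystal3D.Cruxes.TextureLiminf.TexShadow (stacking cyl ZigGood FramesApart corner_of_zigGood framesApart_sep)
open scoped InnerProductSpace

/-- **Lane T's zig `hlines` from `ZigGood₁ ∧ ZigGood₂ ∧ FramesApart`, by name.** -/
theorem barlow_hlines_framesApart
    {sE : EuclideanSpace ℝ (Fin 3)} (hsE : sE ∈ fccSlots) (hcert : ExactOnly 0 (fccSlots.filter fun w => 0 < ⟪w, sE⟫_ℝ))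
    (hDS : ∀ F₁ F₂ : EuclideanSpace ℝ (Fin 3) ≃ₗᵢ[ℝ] EuclideanSpace ℝ (Fin 3), DoubleStarCoaxialAt F₁ F₂) (hCP : CapPairCoaxial)
    (R₀ : ℝ) (hR₀ : 6 ≤ R₀) {σ₁ σ₂ : ℤ → ℤ} (hσ₁ : IsHaggSeq σ₁) (hσ₂ : IsHaggSeq σ₂)
    (L₁ L₂ : EuclideanSpace ℝ (Fin 3) ≃ₗᵢ[ℝ] EuclideanSpace ℝ (Fin 3)) (s₁ s₂ : EuclideanSpace ℝ (Fin 3))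
    (hZ₁ : ZigGood L₁ σ₁ (EuclideanSpace.single (2 : Fin 3) (1 : ℝ)))
    (hZ₂ : ZigGood L₂ σ₂ (-EuclideanSpace.single (2 : Fin 3) (1 : ℝ)))
    (hoff : FramesApart L₁ s₁ σ₁ L₂ s₂ σ₂) :
    ∃ step₁ step₂ : ℤ → EuclideanSpace ℝ (Fin 3),
      IsZigSelector L₁ σ₁ (EuclideanSpace.single (2 : Fin 3) (1 : ℝ)) step₁ ∧
      IsZigSelector L₂ σ₂ (-EuclideanSpace.single (2 : Fin 3) (1 : ℝ)) step₂ ∧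
      ∀ h : ℝ, 0 ≤ h → ∀ ρ : ℝ, R₀ ≤ ρ → ∀ X P₁ P₂ : Finset (EuclideanSpace ℝ (Fin 3)),
      (∀ p ∈ X, ∀ q ∈ X, p ≠ q → 1 ≤ dist p q) → P₁ ⊆ X → P₂ ⊆ X \ P₁ → (∀ p ∈ X, p ∈ cyl R₀ h ρ) →
      (∀ p, p ∈ P₁ ↔ (p ∈ stacking L₁ s₁ σ₁ ∧ -(2 * R₀) ≤ p 2 ∧ p 2 ≤ -R₀ ∧ p 0 ^ 2 + p 1 ^ 2 ≤ ρ ^ 2)) →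
      (∀ p, p ∈ P₂ ↔ (p ∈ stacking L₂ s₂ σ₂ ∧ h + R₀ ≤ p 2 ∧ p 2 ≤ h + 2 * R₀ ∧ p 0 ^ 2 + p 1 ^ 2 ≤ ρ ^ 2)) →
      ∃ (m : ℝ) (T₁ T₂ : Finset (Fin 2 → ℤ)), 0 ≤ m ∧
        (∀ t : Fin 2 → ℤ, (∃ k : ℤ,
          -R₀ - 4 ≤ (L₁ (zigVertexS step₁ k + ((t 0 : ℝ) • triangularVec₁ 1 + (t 1 : ℝ) • triangularVec₂ 1)) + s₁) 2 ∧
          (L₁ (zigVertexS step₁ k + ((t 0 : ℝ) • triangularVec₁ 1 + (t 1 : ℝ) • triangularVec₂ 1)) + s₁) 2 ≤ -R₀ - 3 ∧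
          Real.sqrt ((L₁ (zigVertexS step₁ k + ((t 0 : ℝ) • triangularVec₁ 1 + (t 1 : ℝ) • triangularVec₂ 1)) + s₁) 0 ^ 2 +
            (L₁ (zigVertexS step₁ k + ((t 0 : ℝ) • triangularVec₁ 1 + (t 1 : ℝ) • triangularVec₂ 1)) + s₁) 1 ^ 2) ≤ ρ - m) →
          t ∈ T₁) ∧
        (∀ t : Fin 2 → ℤ, (∃ k : ℤ,
          h + R₀ + 3 ≤ (L₂ (zigVertexS step₂ k + ((t 0 : ℝ) • triangularVec₁ 1 + (t 1 : ℝ) • triangularVec₂ 1)) + s₂) 2 ∧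
          (L₂ (zigVertexS step₂ k + ((t 0 : ℝ) • triangularVec₁ 1 + (t 1 : ℝ) • triangularVec₂ 1)) + s₂) 2 ≤ h + R₀ + 4 ∧
          Real.sqrt ((L₂ (zigVertexS step₂ k + ((t 0 : ℝ) • triangularVec₁ 1 + (t 1 : ℝ) • triangularVec₂ 1)) + s₂) 0 ^ 2 +
            (L₂ (zigVertexS step₂ k + ((t 0 : ℝ) • triangularVec₁ 1 + (t 1 : ℝ) • triangularVec₂ 1)) + s₂) 1 ^ 2) ≤ ρ - m) →
          t ∈ T₂) ∧
        (T₁.card : ℝ) + T₂.card + 18 * m * ρ ≤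
          (∑ y ∈ X.filter (fun y => (X.filter fun q => dist y q = 1).card ≠ 12 ∧ -R₀ - 2 ≤ y 2 ∧ y 2 ≤ h + R₀ + 2),
            ((12 : ℝ) - ((X.filter fun q => dist y q = 1).card : ℝ))) + (318 + 192 * R₀) * (1 + h) * ρ := by
  have he₃' : Summit.Ventures.Crystal3D.Cruxes.TextureLiminf.TexShadow.e₃ = EuclideanSpace.single (2 : Fin 3) (1 : ℝ) := rfl
  have hO3 := framesApart_sep hoff
  obtain ⟨hO1, hO2, -⟩ := hoff
  rw [he₃'] at hO1 hO2 hO3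
  rw [(corner_of_zigGood hZ₁ s₁).2.2.1] at hO1 hO3
  rw [(corner_of_zigGood hZ₂ s₂).2.2.1] at hO2 hO3
  exact barlow_hlines_zigApart hsE hcert hDS hCP R₀ hR₀ hσ₁ hσ₂ L₁ L₂ s₁ s₂ hO1 hO2 hO3 hZ₁.1 hZ₂.1

end Summit.Ventures.Crystal3D.Theorems

end
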